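import Summits.Parity.GeneralizedHardyLittlewood.Theses.LiouvilleShiftedTables
import Summits.Parity.GeneralizedHardyLittlewood.Theorems.TableChowla.Negative.TableChowlaDegenerateWindows

/-!
# `TableChowla` (stmt-Parity-14270) follows from uniform binary Chowla–Elliott for two linear forms

Support lemma for the crux `LiouvilleShiftedTables.TableChowla` (cdisprove seat, "why it
resists"): `tableChowla_of_uniformBinaryChowla : UniformBinaryChowla → TableChowla`, where
`UniformBinaryChowla` asks, for `c ≠ 0` and every `C`, `|Σ_{b ≤ B} λ(ab+c)λ(a'b+c)| ≤ B/(log x)^C`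
uniformly for distinct `a ≠ a' ≤ 2x` and `x^{1/2} ≤ B ≤ x` (a standard, believed, open conjecture:
the forms `ab+c`, `a'b+c` are non-proportional exactly because `c ≠ 0`, `a ≠ a'`). The deduction is
elementary (`momentN_le_of_offDiag`: `T ≤ rows·B² + rows²(εB)²`, plus window bookkeeping and
`4(log x)^C ≤ x^δ` eventually). Consequently a disproof of the crux would refute that conjecture:
the crux sits strictly between the printed averaged-Chowla theorems and it. [folklore]
-/

namespace Summit.Parity.GeneralizedHardyLittlewood.Theorems.TableChowla.Negative

open Finset Real ArithmeticFunction
open Summit.Parity.GeneralizedHardyLittlewood.Theses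

noncomputable section

variable {f : ℕ → ℝ} {c : ℤ} {A₁ A₂ B : ℕ}

/-- Trivial bound `|S_f(a,a')| ≤ B` for `|f| ≤ 1`. -/
theorem abs_rowCorr_le (hf : ∀ n, |f n| ≤ 1) (a a' : ℕ) : |rowCorr f c B a a'| ≤ B := by
  unfold rowCorr
  calc |∑ b ∈ Icc 1 B, f (Int.toNat ((a : ℤ) * b + c)) * f (Int.toNat ((a' : ℤ) * b + c))|
        ≤ ∑ b ∈ Icc 1 B, |f (Int.toNat ((a : ℤ) * b + c)) * f (Int.toNat ((a' : ℤ) * b + c))| :=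
          abs_sum_le_sum_abs _ _
    _ ≤ ∑ _b ∈ Icc 1 B, (1 : ℝ) := by
          refine sum_le_sum fun b _ => ?_
          rw [abs_mul]
          exact mul_le_one₀ (hf _) (abs_nonneg _) (hf _)
    _ = B := by simp

/-- COMBINATORIAL CORE of the reduction: if `|f| ≤ 1` and every OFF-diagonal row correlation is at
most `ε B`, then `T ≤ rows · B² + rows² · (ε B)²`. -/
theorem momentN_le_of_offDiag (hf : ∀ n, |f n| ≤ 1) {ε : ℝ}
    (hoff : ∀ a ∈ Ioc A₁ A₂, ∀ a' ∈ Ioc A₁ A₂, a ≠ a' → |rowCorr f c B a a'| ≤ ε * B) :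
    momentN f c A₁ A₂ B ≤
      (Ioc A₁ A₂).card * (B : ℝ) ^ 2 + ((Ioc A₁ A₂).card : ℝ) ^ 2 * (ε * B) ^ 2 := by
  unfold momentN
  have hrow : ∀ a ∈ Ioc A₁ A₂, ∑ a' ∈ Ioc A₁ A₂, rowCorr f c B a a' ^ 2 ≤
      (B : ℝ) ^ 2 + (Ioc A₁ A₂).card * (ε * B) ^ 2 := by
    intro a ha
    rw [← Finset.add_sum_erase _ _ ha]
    have hdiag : rowCorr f c B a a ^ 2 ≤ (B : ℝ) ^ 2 := by
      have hb := abs_rowCorr_le (c := c) (B := B) hf a a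
      exact sq_le_sq' (by linarith [(abs_le.mp hb).1]) (abs_le.mp hb).2
    have hoffsum : ∑ a' ∈ (Ioc A₁ A₂).erase a, rowCorr f c B a a' ^ 2 ≤
        (Ioc A₁ A₂).card * (ε * B) ^ 2 := by
      calc ∑ a' ∈ (Ioc A₁ A₂).erase a, rowCorr f c B a a' ^ 2
            ≤ ∑ _a' ∈ (Ioc A₁ A₂).erase a, (ε * B) ^ 2 := by
              refine sum_le_sum fun a' ha' => ?_
              have hne : a ≠ a' := (Finset.ne_of_mem_erase ha').symm
              have hmem : a' ∈ Ioc A₁ A₂ := Finset.mem_of_mem_erase ha'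
              have hb := hoff a ha a' hmem hne
              exact sq_le_sq' (by linarith [(abs_le.mp hb).1]) (abs_le.mp hb).2
        _ ≤ ∑ _a' ∈ Ioc A₁ A₂, (ε * B) ^ 2 :=
              sum_le_sum_of_subset_of_nonneg (erase_subset _ _) (fun _ _ _ => sq_nonneg _)
        _ = (Ioc A₁ A₂).card * (ε * B) ^ 2 := by simp
    linarith
  calc ∑ a ∈ Ioc A₁ A₂, ∑ a' ∈ Ioc A₁ A₂, rowCorr f c B a a' ^ 2
      ≤ ∑ _a ∈ Ioc A₁ A₂, ((B : ℝ) ^ 2 + (Ioc A₁ A₂).card * (ε * B) ^ 2) := sum_le_sum hrow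
    _ = _ := by simp only [sum_const, nsmul_eq_mul]; ring

/-- HYPOTHESIS — uniform binary Chowla–Elliott for two linear forms (believed; open; the `q = 1`,
two-form cousin of `Literature.Barriers.Parity.Polymath2014_liouvillePairAP`): for `c ≠ 0` and
every `C`, beyond some `x₀(c, C)`, uniformly for DISTINCT coefficients `a ≠ a'` up to `2x` and
lengths `x^{1/2} ≤ B ≤ x`: `|∑_{b ≤ B} λ(ab+c) λ(a'b+c)| ≤ B/(log x)^C`. The forms `ab+c`, `a'b+c` are
non-proportional precisely because `c ≠ 0` and `a ≠ a'`. -/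
def UniformBinaryChowla : Prop :=
  ∀ c : ℤ, c ≠ 0 → ∀ C : ℝ, 0 < C → ∃ x₀ : ℝ, ∀ x : ℝ, x₀ ≤ x → ∀ a a' B : ℕ, a ≠ a' →
    (a : ℝ) ≤ 2 * x → (a' : ℝ) ≤ 2 * x → x ^ ((1 : ℝ) / 2) ≤ B → (B : ℝ) ≤ x →
      |rowCorr lam c B a a'| ≤ B / Real.log x ^ C

/-- RESISTANCE THEOREM: `UniformBinaryChowla ⟹ TableChowla`. -/
theorem tableChowla_of_uniformBinaryChowla (h : UniformBinaryChowla) :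
    LiouvilleShiftedTables.TableChowla := by
  rw [tableChowla_iff]
  intro c hc δ hδ hδ12 C hC
  obtain ⟨x₁, hx₁⟩ := h c hc C hC
  -- (i) eventually 4 (log x)^C ≤ x^δ
  have hev : ∀ᶠ x in Filter.atTop, ‖Real.log x ^ C‖ ≤ 1 / 4 * ‖x ^ δ‖ :=
    (isLittleO_log_rpow_rpow_atTop C hδ).bound (by norm_num)
  obtain ⟨X, hX⟩ := Filter.eventually_atTop.mp hev
  -- (ii) (log x)^C ≥ 8 once log x ≥ L₀ := 8^(1/C)
  set L₀ : ℝ := (8 : ℝ) ^ (1 / C) with hL₀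
  refine ⟨max (max x₁ 4096) (max (Real.exp (max L₀ 1)) X), fun x hx A hA1 hA2 => ?_⟩
  have hxx₁ : x₁ ≤ x := le_trans (le_trans (le_max_left _ _) (le_max_left _ _)) hx
  have hx4096 : (4096 : ℝ) ≤ x := le_trans (le_trans (le_max_right _ _) (le_max_left _ _)) hx
  have hxexp : Real.exp (max L₀ 1) ≤ x := le_trans (le_trans (le_max_left _ _) (le_max_right _ _)) hx
  have hxX : X ≤ x := le_trans (le_trans (le_max_right _ _) (le_max_right _ _)) hx
  have hx1 : (1 : ℝ) < x := by linarith
  have hxpos : (0 : ℝ) < x := by linarith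
  have hlogmax : max L₀ 1 ≤ Real.log x := (Real.le_log_iff_exp_le hxpos).mpr hxexp
  have hlog1 : (1 : ℝ) ≤ Real.log x := le_trans (le_max_right _ _) hlogmax
  have hlogL : L₀ ≤ Real.log x := le_trans (le_max_left _ _) hlogmax
  have hlogpos : 0 < Real.log x := by linarith
  set L : ℝ := Real.log x ^ C with hL
  have hLpos : 0 < L := Real.rpow_pos_of_pos hlogpos C
  have hL8 : 8 ≤ L := by
    calc (8 : ℝ) = L₀ ^ C := by
          rw [hL₀, ← Real.rpow_mul (by norm_num), one_div_mul_cancel hC.ne', Real.rpow_one]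
      _ ≤ L := Real.rpow_le_rpow (by positivity) hlogL hC.le
  have hXb : 4 * L ≤ x ^ δ := by
    have := hX x hxX
    rw [Real.norm_eq_abs, Real.norm_eq_abs, abs_of_nonneg (Real.rpow_nonneg hlogpos.le C),
      abs_of_nonneg (Real.rpow_nonneg hxpos.le δ)] at this
    rw [hL]; linarith
  -- sizes of the table
  set S : Finset ℕ := Ioc ⌊A⌋₊ ⌊2 * A⌋₊ with hS
  set Bn : ℕ := ⌊x / A⌋₊ with hBn
  have hAone : 1 ≤ A := le_trans (Real.one_le_rpow hx1.le hδ.le) hA1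
  have hApos : 0 < A := by linarith
  have hAx : A ≤ x := hA2.trans (by
    calc x ^ (1 / 3 + δ) ≤ x ^ (1 : ℝ) := Real.rpow_le_rpow_of_exponent_le hx1.le (by linarith)
      _ = x := Real.rpow_one x)
  have h2Afl : (⌊2 * A⌋₊ : ℝ) ≤ 2 * A := Nat.floor_le (by linarith)
  have hcardR : (S.card : ℝ) ≤ 2 * A := by
    rw [hS, Nat.card_Ioc, Nat.cast_sub (Nat.floor_le_floor (by linarith : A ≤ 2 * A))]
    have h2 : A - 1 < (⌊A⌋₊ : ℝ) := by have := Nat.lt_floor_add_one A; linarith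
    linarith
  have hBle : (Bn : ℝ) ≤ x / A := Nat.floor_le (by positivity)
  have hBx : (Bn : ℝ) ≤ x := hBle.trans (div_le_self hxpos.le hAone)
  have hRB : (S.card : ℝ) * Bn ≤ 2 * x := by
    calc (S.card : ℝ) * Bn ≤ (2 * A) * (x / A) :=
          mul_le_mul hcardR hBle (by positivity) (by positivity)
      _ = 2 * x := by field_simp
  have hRB2 : (S.card : ℝ) * (Bn : ℝ) ^ 2 ≤ 2 * x ^ 2 / x ^ δ := by
    calc (S.card : ℝ) * (Bn : ℝ) ^ 2 ≤ (2 * A) * (x / A) ^ 2 :=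
          mul_le_mul hcardR (pow_le_pow_left₀ (by positivity) hBle 2) (by positivity) (by positivity)
      _ = 2 * x ^ 2 / A := by field_simp
      _ ≤ 2 * x ^ 2 / x ^ δ := div_le_div_of_nonneg_left (by positivity) (by positivity) hA1
  -- B ≥ x^{1/2}
  have hBlow : x ^ ((1 : ℝ) / 2) ≤ Bn := by
    have h1 : x / x ^ (1 / 3 + δ) ≤ x / A := div_le_div_of_nonneg_left hxpos.le hApos hA2
    have h2 : x / x ^ (1 / 3 + δ) = x ^ (2 / 3 - δ) := by
      rw [div_eq_iff (by positivity), ← Real.rpow_add hxpos]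
      norm_num
    have h3 : x ^ ((7 : ℝ) / 12) ≤ x ^ (2 / 3 - δ) :=
      Real.rpow_le_rpow_of_exponent_le hx1.le (by linarith)
    have h4 : x ^ ((7 : ℝ) / 12) = x ^ ((1 : ℝ) / 2) * x ^ ((1 : ℝ) / 12) := by
      rw [← Real.rpow_add hxpos]; norm_num
    have h5 : (2 : ℝ) ≤ x ^ ((1 : ℝ) / 12) := by
      have e : ((2 : ℝ) ^ (12 : ℕ)) ^ ((1 : ℝ) / 12) = 2 := by
        rw [show ((1 : ℝ) / 12) = ((12 : ℕ) : ℝ)⁻¹ by norm_num]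
        exact Real.pow_rpow_inv_natCast (by norm_num) (by norm_num)
      calc (2 : ℝ) = ((2 : ℝ) ^ (12 : ℕ)) ^ ((1 : ℝ) / 12) := e.symm
        _ ≤ x ^ ((1 : ℝ) / 12) := Real.rpow_le_rpow (by norm_num) (by norm_num; linarith) (by norm_num)
    have h6 : 1 ≤ x ^ ((1 : ℝ) / 2) := Real.one_le_rpow hx1.le (by norm_num)
    have h7 : x / A - 1 < Bn := by have := Nat.lt_floor_add_one (x / A); rw [hBn]; linarith
    have h8 : 2 * x ^ ((1 : ℝ) / 2) ≤ x ^ ((1 : ℝ) / 2) * x ^ ((1 : ℝ) / 12) := by nlinarith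
    linarith
  -- rows are ≤ 2x
  have harow : ∀ a ∈ S, (a : ℝ) ≤ 2 * x := by
    intro a ha
    rw [hS, mem_Ioc] at ha
    have : (a : ℝ) ≤ ⌊2 * A⌋₊ := by exact_mod_cast ha.2
    linarith
  -- the hypothesis on the off-diagonal pairs, with ε = 1/L
  have hoff : ∀ a ∈ S, ∀ a' ∈ S, a ≠ a' → |rowCorr lam c Bn a a'| ≤ 1 / L * Bn := by
    intro a ha a' ha' hne
    have hb := hx₁ x hxx₁ a a' Bn hne (harow a ha) (harow a' ha') hBlow hBx
    rw [hL, one_div_mul_eq_div]; exact hb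
  have hT := momentN_le_of_offDiag (f := lam) (c := c) (A₁ := ⌊A⌋₊) (A₂ := ⌊2 * A⌋₊) (B := Bn)
    abs_lam_le_one hoff
  rw [← hS] at hT
  -- assemble: T ≤ rows B² + rows² (B/L)² ≤ 2x²/x^δ + 4x²/L² ≤ x²/(2L) + x²/(2L) = x²/L
  have t2 : 2 * x ^ 2 / x ^ δ ≤ x ^ 2 / (2 * L) := by
    rw [div_le_div_iff₀ (by positivity) (by positivity)]
    nlinarith [mul_le_mul_of_nonneg_right hXb (sq_nonneg x)]
  have t3 : (S.card : ℝ) ^ 2 * (1 / L * Bn) ^ 2 ≤ (2 * x) ^ 2 * (1 / L) ^ 2 := by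
    have e1 : (S.card : ℝ) ^ 2 * (1 / L * Bn) ^ 2 = ((S.card : ℝ) * Bn) ^ 2 * (1 / L) ^ 2 := by ring
    rw [e1]
    exact mul_le_mul_of_nonneg_right (pow_le_pow_left₀ (by positivity) hRB 2) (sq_nonneg _)
  have t4 : (2 * x) ^ 2 * (1 / L) ^ 2 ≤ x ^ 2 / (2 * L) := by
    rw [one_div_pow, mul_one_div, div_le_div_iff₀ (by positivity) (by positivity)]
    nlinarith [mul_nonneg (sq_nonneg x) hLpos.le]
  have t5 : x ^ 2 / (2 * L) + x ^ 2 / (2 * L) = x ^ 2 / L := by field_simp; ring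
  show momentN lam c ⌊A⌋₊ ⌊2 * A⌋₊ ⌊x / A⌋₊ ≤ x ^ 2 / L
  rw [← hBn]
  linarith

end

end Summit.Parity.GeneralizedHardyLittlewood.Theorems.TableChowla.Negative
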